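import Literature.Computability.AlgebraicComplexity.ASSS16DepthThreeCertificate
import Literature.Computability.AlgebraicComplexity.FSV18Lemma53Reduction
import Literature.Computability.AlgebraicComplexity.FSV18Thm9AssemblyL40
import Literature.NumberTheory.DiophantineGeometry.CafureMateraProofs
import HarnessLib

/-!
# Forbes–Shpilka–Volk 2018, Lemma 23 (ToC Lemma 4.8) from Lemma 52 — PROOF of the printed
# [ASSS16, §3] argument (val-lit p1 g3; N1 support)

Topic `Literature/Computability/AlgebraicComplexity`; theorems only (no definitions, no named
facts). Sources: M. A. Forbes, A. Shpilka, B. L. Volk, *Succinct hitting sets and barriers to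
proving lower bounds for algebraic circuits*, ToC 14 (2018) = arXiv:1701.05328 (Lemma 23 = ToC
Lemma 4.8, quoted from [ASSS16]; held `paper:arxiv-1701.05328` chunk p0017); M. Agrawal, C. Saha,
R. Saptharishi, N. Saxena, *Jacobian hits circuits*, arXiv:1111.0582 = STOC 2012 / SICOMP 2016,
§3 "Hitting-set for constant transcendence degree depth-3 circuits" (held `paper:arxiv-1111.0582`
chunk p0007; proofs §7.2, chunks p0017–p0018). Bib keys `ForbesShpilkaVolk2018`, `AgrawalEtAl2011`.

`FSV18SuccinctGenerators.lean` (val-lit t18) types FSV Lemma 23 as the NAMED FACT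
`FSV2018_lemma23` — the map `Ψ : X_i ↦ Σ_{j ≤ k+1} z_j s^{ij} + Σ_{j ≤ k} y_j t^{ij}`
(`asssPsiGenCoeff`) is a hitting-set generator for `C(T_1, …, T_M)` with `T_i` products of `d`
linear functions and `trdeg ≤ k`, in characteristic `0` or `> d^k` — one of the residual external
inputs of the LOAD-BEARING `FSV2018_thm9` (`FSV2018_thm9_of_fiveFacts`). `FSV2018ROABP.lean` types
FSV Lemma 52 = [ASSS16, Lemma 2.2] (the faithful recipe `X_i ↦ Σ_j y_j t^{ij} + Φ(X_i)` for any `Φ`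
preserving the rank of the Jacobian) as `ForbesShpilkaVolk2018_lemma52`, a THEOREM in
characteristic `0` (`ForbesShpilkaVolk2018_lemma52_of_charZero`, val-lit t18) and over every field
modulo the sharp Perron bound (`ForbesShpilkaVolk2018_lemma52_of_perron`, val-lit t21).

This file PROVES the printed deduction of Lemma 23 from Lemma 2.2 ([ASSS16, §3]: "By Lemma 2.2, if
we construct a `Ψ : 𝔽[x] → 𝔽[z]` that keeps `J_{x_k}(T_k)` nonzero then `Ψ` can easily be extended
to a homomorphism … faithful to `T`"; eq. (1); Lemma 3.1; Thm. 3.2; "one of the maps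
`Ψ_b : x_i ↦ Σ_{j=1}^{k+1} z_j b^{ij}` … is a rank-`(k+1)` preserving map", here with FSV's formal
`b = s`):

* `ASSS16.det_jacobian_submatrix_prod_affine` — **eq. (1)**: a Jacobian minor of products of affine
  forms is `Σ_J det(v_{i,J(i)}) · ∏_i ∏_{j ≠ J(i)} ℓ_{ij}` (Leibniz rule + multilinearity of `det`);
  `ASSS16.sum_graph_eq_sum_powersetCard` re-indexes it into the shape of the certificate theorem
  `ASSS16.aeval_affine_ne_zero_of_rankPreserving` (`ASSS16DepthThreeCertificate.lean`, Lemma 3.1 +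
  Thm. 3.2), and `ASSS16.linearIndependent_of_graph_det_ne_zero` is "the term `J(ℓ_1, …, ℓ_k)`
  ensures that the sum is only over independent linear polynomials".
* `ASSS16.linearIndependent_vecMul_vandermonde` — the formal-`s` Vandermonde map is
  rank-preserving over `𝔽(s)` (Gabizon–Raz, t18's `ASSS16.det_mul_powMatrix_ne_zero` = Lemma 7.1).
* `ASSS16.aeval_vandermonde_det_jacobian_ne_zero` — hence `X_κ ↦ Σ_b z_b s^{(b+1)(κ+1)}` keeps
  every non-zero `r × r` Jacobian minor (`r ≤ k`) of products of affine forms non-zero (the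
  certificate over `𝔽(s)`, pulled back along the coefficient map `𝔽[z, s] → 𝔽(s)[z]`).
* **`isHittingSetGenerator_asssPsiGenCoeff_of_lemma52`** / **`FSV2018_lemma23_of_lemma52`** —
  Lemma 23 from Lemma 52, following val-lit t21's `ForbesShpilkaVolk2018_lemma53_of_lemma52`
  template (`jacobianRank_eq_rank_map_of_minors`, `jacobianRank_le_of_trdegLE`,
  `binIndex_eq_binaryOrder_symm_succ`); corollaries **`FSV2018_lemma23_of_fact51`**,
  **`FSV2018_lemma23_of_perron`**, **`isHittingSetGenerator_asssPsiGenCoeff_of_charZero`** (Lemma 23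
  is a THEOREM over fields of characteristic `0`), `FSV2018_thm24_of_lemma52`,
  `FSV2018_thm9_trdeg_of_perron`, and **`FSV2018_thm9_of_twoFacts_of_perron`** /
  **`FSV2018_thm9_of_twoFacts_of_lemma52`** / `…_of_fact51`: the LOAD-BEARING `FSV2018_thm9` from
  {Fact 19 [SS], Thm. 48 [ASSS16]} and `perronTheorem_sharp` [BMS13 Thm. 4] (resp. Lemma 52
  [ASSS16 Lemma 2.2] ∀F, resp. Fact 51 ∀F) — Lemma 40 being the theorem `FSV2018_lemma40_holds`
  (val-lit t19, `FSV18Thm9AssemblyL40`).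

Honest framing: a printed lemma of [ASSS16]/[FSV18] re-proved in the kernel; the residual inputs of
the N1 row shrink by one (`FSV2018_lemma23`): {Fact 19, Thm. 48} + Perron / Lemma 52. `VP ≠ VNP` is NOT proved and nothing here is
progress on it.

## References
* [ForbesShpilkaVolk2018] FSV, ToC 14(18) (2018), Lemma 23 (seq.) = ToC Lemma 4.8; Thm. 24; Thm. 9.
  locator: paper:arxiv-1701.05328 p0017.txt:L5–L15.
* [AgrawalEtAl2011] ASSS, arXiv:1111.0582, §3 (eq. (1), Lemma 3.1, Thm. 3.2, Lemma 2.2) and §7.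
  locator: paper:arxiv-1111.0582 p0007.txt, p0017.txt, p0018.txt.
* [BeeckenMittmannSaxena2013] BMS, Inf. Comput. 222 (the Jacobian criterion; Thm. 4 = Perron).
-/

noncomputable section

namespace Literature.Computability.AlgebraicComplexity

namespace ASSS16

open MvPolynomial Finset

section JacobianExpansion

variable {K : Type*} [Field K]

/-- Leibniz rule for a partial derivative of a finite product. [folklore] -/
private theorem pderiv_finset_prod {σ α : Type*} [DecidableEq α] (i : σ) (s : Finset α)
    (f : α → MvPolynomial σ K) :
    pderiv i (∏ j ∈ s, f j) = ∑ j ∈ s, (∏ j' ∈ s.erase j, f j') * pderiv i (f j) := by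
  induction s using Finset.induction_on with
  | empty => simp
  | insert a s ha ih =>
    rw [Finset.prod_insert ha, Derivation.leibniz, ih, Finset.sum_insert ha, Finset.erase_insert ha,
      smul_eq_mul, smul_eq_mul]
    have key : ∀ j ∈ s, (∏ j' ∈ (insert a s).erase j, f j') = f a * ∏ j' ∈ s.erase j, f j' := by
      intro j hj
      have hja : a ≠ j := fun h => ha (h ▸ hj)
      rw [Finset.erase_insert_of_ne hja, Finset.prod_insert (fun h => ha (Finset.mem_of_mem_erase h))]
    rw [add_comm, Finset.mul_sum]
    congr 1
    exact Finset.sum_congr rfl fun j hj => by rw [key j hj]; ring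

/-- **Eq. (1) of [ASSS16, §3]: the Jacobian minor of products of affine forms.** For
`T_i = ∏_j ℓ_{ij}` with affine `ℓ_{ij} = c_{ij} + Σ_x v_{ij,x} X_x`: "`∂T_i/∂x = T_i · (Σ_j (∂ℓ_{ij}/∂x)/ℓ_{ij})`.
By expanding, using this additive structure of `∂T_i/∂x` and the linearity of determinant wrt
rows, `J_{x_k}(T_1, …, T_k) = Σ_{ℓ_1 ∈ L(T_1), …, ℓ_k ∈ L(T_k)} (T_1⋯T_k)/(ℓ_1⋯ℓ_k) · J_{x_k}(ℓ_1, …, ℓ_k)`"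
— here with denominators cleared: the sum over the choice functions `J` of the scalar determinant
`det (v_{i,J(i),x})` times `∏_i ∏_{j ≠ J(i)} ℓ_{ij}`, for any rows `ρ` and columns `γ`.
[cite: AgrawalEtAl2011, §3 (eq. (1))] locator: paper:arxiv-1111.0582 p0007.txt:L24–L34 -/
theorem det_jacobian_submatrix_prod_affine {m d N r : ℕ} (c : Fin m → Fin d → K)
    (v : Fin m → Fin d → Fin N → K) (ρ : Fin r → Fin m) (γ : Fin r → Fin N) :
    ((Literature.Algebra.Polynomial.JacobianCriterion.jacobianMatrix (fun i => ∏ j,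
        (C (c i j) + ∑ x, C (v i j x) * X x : MvPolynomial (Fin N) K))).submatrix ρ γ).det =
      ∑ J : Fin r → Fin d, C (Matrix.det (Matrix.of fun a b : Fin r => v (ρ a) (J a) (γ b))) *
        ∏ a, ∏ j ∈ Finset.univ.erase (J a), (C (c (ρ a) j) + ∑ x, C (v (ρ a) j x) * X x) := by
  classical
  -- the rows of the minor as sums over the factors
  set g : Fin r → Fin d → (Fin r → MvPolynomial (Fin N) K) := fun a j b =>
    (∏ j' ∈ Finset.univ.erase j, (C (c (ρ a) j') + ∑ x, C (v (ρ a) j' x) * X x :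
      MvPolynomial (Fin N) K)) * C (v (ρ a) j (γ b)) with hg
  have hM : ((Literature.Algebra.Polynomial.JacobianCriterion.jacobianMatrix (fun i => ∏ j,
        (C (c i j) + ∑ x, C (v i j x) * X x : MvPolynomial (Fin N) K))).submatrix ρ γ) =
      fun a => ∑ j, g a j := by
    funext a b
    rw [Matrix.submatrix_apply, Literature.Algebra.Polynomial.JacobianCriterion.jacobianMatrix_apply,
      pderiv_finset_prod, Finset.sum_apply]
    refine Finset.sum_congr rfl fun j _ => ?_
    rw [hg, pderiv_affine]
  rw [hM]
  have hmulti := (Matrix.detRowAlternating :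
      (Fin r → MvPolynomial (Fin N) K) [⋀^Fin r]→ₗ[MvPolynomial (Fin N) K]
        MvPolynomial (Fin N) K).toMultilinearMap.map_sum g
  simp only [AlternatingMap.coe_multilinearMap] at hmulti
  change Matrix.detRowAlternating (fun a => ∑ j, g a j) = _
  rw [hmulti]
  refine Finset.sum_congr rfl fun J _ => ?_
  change Matrix.det (fun a => g a (J a)) = _
  have e1 : (fun a => g a (J a)) = Matrix.of (fun a b =>
      (∏ j' ∈ Finset.univ.erase (J a), (C (c (ρ a) j') + ∑ x, C (v (ρ a) j' x) * X x :
        MvPolynomial (Fin N) K)) *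
      (Matrix.of fun a b : Fin r => (C (v (ρ a) (J a) (γ b)) : MvPolynomial (Fin N) K)) a b) := by
    funext a b
    rfl
  rw [e1, Matrix.det_mul_column, mul_comm]
  congr 1
  have e2 : (Matrix.of fun a b : Fin r => (C (v (ρ a) (J a) (γ b)) : MvPolynomial (Fin N) K)) =
      (C : K →+* MvPolynomial (Fin N) K).mapMatrix (Matrix.of fun a b : Fin r => v (ρ a) (J a) (γ b)) := by
    ext a b
    rfl
  rw [e2, ← RingHom.map_det]

end JacobianExpansion

section Flatten

variable {R : Type*} [CommRing R] {r d : ℕ}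

/-- Re-indexing the choice functions `J` (one factor per row) by their graphs `L ⊆ rows × factors`
(`|L| = r`): the expansion eq. (1) in the shape `Σ_L α_L ∏_{a ∉ L} q_a` of
`aeval_affine_ne_zero_of_rankPreserving`. [cite: AgrawalEtAl2011, §3 (eq. (1))]
locator: paper:arxiv-1111.0582 p0007.txt:L28–L34 -/
theorem sum_graph_eq_sum_powersetCard (δ : (Fin r → Fin d) → R) (q : Fin r × Fin d → R) :
    ∑ J : Fin r → Fin d, δ J * ∏ a, ∏ j ∈ Finset.univ.erase (J a), q (a, j) =
      ∑ L ∈ (Finset.univ : Finset (Fin r × Fin d)).powersetCard r,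
        (∑ J : Fin r → Fin d, if Finset.univ.image (fun a => (a, J a)) = L then δ J else 0) *
          ∏ p ∈ Finset.univ \ L, q p := by
  classical
  have hgraph : ∀ J : Fin r → Fin d,
      Finset.univ.image (fun a => (a, J a)) ∈ (Finset.univ : Finset (Fin r × Fin d)).powersetCard r := by
    intro J
    rw [Finset.mem_powersetCard]
    refine ⟨Finset.subset_univ _, ?_⟩
    rw [Finset.card_image_of_injective _ (fun a b h => (Prod.ext_iff.1 h).1), Finset.card_univ,
      Fintype.card_fin]
  have hprod : ∀ J : Fin r → Fin d,
      ∏ p ∈ Finset.univ \ Finset.univ.image (fun a => (a, J a)), q p =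
        ∏ a, ∏ j ∈ Finset.univ.erase (J a), q (a, j) := by
    intro J
    have hset : Finset.univ \ Finset.univ.image (fun a => (a, J a)) =
        (Finset.univ : Finset (Fin r × Fin d)).filter (fun p => p.2 ≠ J p.1) := by
      ext p
      simp only [Finset.mem_sdiff, Finset.mem_univ, Finset.mem_image, true_and, Finset.mem_filter]
      constructor
      · intro h hp
        exact h ⟨p.1, by rw [← hp]⟩
      · rintro h ⟨a, ha⟩
        apply h
        rw [← ha]
    rw [hset, Finset.prod_filter, Fintype.prod_prod_type]
    refine Finset.prod_congr rfl fun a _ => ?_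
    rw [← Finset.filter_ne', Finset.prod_filter]
  symm
  calc ∑ L ∈ (Finset.univ : Finset (Fin r × Fin d)).powersetCard r,
        (∑ J : Fin r → Fin d, if Finset.univ.image (fun a => (a, J a)) = L then δ J else 0) *
          ∏ p ∈ Finset.univ \ L, q p
      = ∑ L ∈ (Finset.univ : Finset (Fin r × Fin d)).powersetCard r, ∑ J : Fin r → Fin d,
          (if Finset.univ.image (fun a => (a, J a)) = L then δ J * ∏ p ∈ Finset.univ \ L, q p else 0) := by
        refine Finset.sum_congr rfl fun L _ => ?_
        rw [Finset.sum_mul]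
        refine Finset.sum_congr rfl fun J _ => ?_
        split_ifs <;> simp
    _ = ∑ J : Fin r → Fin d, ∑ L ∈ (Finset.univ : Finset (Fin r × Fin d)).powersetCard r,
          (if Finset.univ.image (fun a => (a, J a)) = L then δ J * ∏ p ∈ Finset.univ \ L, q p else 0) :=
        Finset.sum_comm
    _ = ∑ J : Fin r → Fin d, δ J * ∏ a, ∏ j ∈ Finset.univ.erase (J a), q (a, j) := by
        refine Finset.sum_congr rfl fun J _ => ?_
        rw [Finset.sum_ite_eq, if_pos (hgraph J), hprod]

end Flatten

section Support

variable {K : Type*} [Field K] {r d N : ℕ}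

/-- The coefficient at a graph `L` is a scalar Jacobian `det (v_{a,J a}|_γ)`; when it survives,
the full vectors `(v_p)_{p ∈ L}` are linearly independent ("the term `J(ℓ_1, …, ℓ_k)` ensures that
the sum is only over independent linear polynomials"). [cite: AgrawalEtAl2011, §3 (after eq. (1))]
locator: paper:arxiv-1111.0582 p0007.txt:L36–L40 -/
theorem linearIndependent_of_graph_det_ne_zero (v : Fin r × Fin d → Fin N → K) (γ : Fin r → Fin N)
    (L : Finset (Fin r × Fin d))
    (h : (∑ J : Fin r → Fin d, if Finset.univ.image (fun a => (a, J a)) = L then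
      Matrix.det (Matrix.of fun a b : Fin r => v (a, J a) (γ b)) else 0) ≠ 0) :
    LinearIndependent K (fun p : L => v p) := by
  classical
  obtain ⟨J, -, hJ⟩ := Finset.exists_ne_zero_of_sum_ne_zero h
  have hL : Finset.univ.image (fun a => (a, J a)) = L := by
    by_contra hne
    exact hJ (if_neg hne)
  rw [if_pos hL] at hJ
  -- the rows `a ↦ v (a, J a)` are linearly independent
  have hrows : LinearIndependent K (fun a : Fin r => v (a, J a)) := by
    rw [Fintype.linearIndependent_iff]
    intro g hg
    have hvec : Matrix.vecMul g (Matrix.of fun a b : Fin r => v (a, J a) (γ b)) = 0 := by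
      funext b
      have := congrFun hg (γ b)
      simpa [Matrix.vecMul, dotProduct, Finset.sum_apply, Pi.smul_apply, smul_eq_mul] using this
    exact congrFun (Matrix.eq_zero_of_vecMul_eq_zero hJ hvec)
  -- transport along the bijection `a ↦ (a, J a)` onto `L`
  have hmem : ∀ a : Fin r, (a, J a) ∈ L := fun a => by
    rw [← hL]
    exact Finset.mem_image_of_mem _ (Finset.mem_univ a)
  set e : Fin r → ↥L := fun a => ⟨(a, J a), hmem a⟩ with he
  have hbij : Function.Bijective e := by
    constructor
    · intro a b hab
      have := congrArg (fun p : ↥L => (p : Fin r × Fin d).1) hab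
      exact this
    · rintro ⟨p, hp⟩
      rw [← hL] at hp
      obtain ⟨a, -, ha⟩ := Finset.mem_image.1 hp
      exact ⟨a, Subtype.ext ha⟩
  rw [← linearIndependent_equiv (Equiv.ofBijective e hbij)]
  exact hrows

end Support

end ASSS16


namespace ASSS16

open MvPolynomial Finset

section Vandermonde

variable {F : Type*} [Field F] {ι : Type*} {N μ : ℕ}

/-- **The formal-`s` Vandermonde map is rank-preserving** (the hypothesis of Thm. 3.2 in the form
FSV Lemma 23 supplies it: `X_i ↦ Σ_{j ≤ μ} z_j s^{ij}` with an indeterminate `s`): over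
`𝔽(s)`, multiplication by `(s^{ij})_{i ≤ N, j ≤ μ}` keeps every linearly independent family of at
most `μ` vectors of `𝔽^N` linearly independent — by the Gabizon–Raz lowest-term argument
(`ASSS16.det_mul_powMatrix_ne_zero`, Lemma 7.1) on the square minor of the first `|family|` columns.
[cite: AgrawalEtAl2011, Lemma 7.1 and Cor. 7.2] locator: paper:arxiv-1111.0582 p0017.txt:L31–L50 -/
theorem linearIndependent_vecMul_vandermonde (v₀ : ι → Fin N → F) (s : Finset ι) (hs : s.card ≤ μ)
    (h : LinearIndependent (FractionRing (Polynomial F))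
      (fun p : s => fun κ => algebraMap F (FractionRing (Polynomial F)) (v₀ p κ))) :
    LinearIndependent (FractionRing (Polynomial F)) (fun p : s =>
      Matrix.vecMul (fun κ => algebraMap F (FractionRing (Polynomial F)) (v₀ p κ))
        (Matrix.of fun (κ : Fin N) (b : Fin μ) =>
          algebraMap (Polynomial F) (FractionRing (Polynomial F)) (Polynomial.X ^ (((b : ℕ) + 1) * ((κ : ℕ) + 1))))) := by
  classical
  set K := FractionRing (Polynomial F)
  set φ : F →+* K := algebraMap F K with hφ
  set ψ : (Polynomial F) →+* K := algebraMap (Polynomial F) K with hψ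
  have hφψ : φ = ψ.comp Polynomial.C := by
    rw [hφ, hψ, IsScalarTower.algebraMap_eq F (Polynomial F) K, Polynomial.algebraMap_eq]
  -- the family over `F` is linearly independent
  set m := s.card with hm
  set e : ↥s ≃ Fin m := s.equivFin with he
  set Q : Matrix (Fin m) (Fin N) F := fun a κ => v₀ (e.symm a) κ with hQ
  have hQ' : LinearIndependent F (fun a : Fin m => Q a) := by
    rw [Fintype.linearIndependent_iff]
    intro g hg a
    rw [Fintype.linearIndependent_iff] at h
    have h1 := h (fun p => φ (g (e p))) (by
      funext κ
      have := congrFun hg κ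
      simp only [Finset.sum_apply, Pi.smul_apply, smul_eq_mul, Pi.zero_apply, hQ] at this ⊢
      have h2 := congrArg φ this
      rw [map_sum, map_zero] at h2
      rw [← Equiv.sum_comp e.symm (fun p : ↥s => φ (g (e p)) * φ (v₀ p κ))]
      rw [← h2]
      refine Finset.sum_congr rfl fun a _ => ?_
      rw [map_mul, Equiv.apply_symm_apply])
    have h2 := h1 (e.symm a)
    rw [Equiv.apply_symm_apply] at h2
    exact (map_eq_zero φ).1 h2
  -- Lemma 7.1: the square minor on the first `m` Vandermonde columns is non-singular
  have hGR := det_mul_powMatrix_ne_zero Q hQ'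
  set D : Matrix (Fin m) (Fin m) K := ((Q.map (Polynomial.C : F →+* (Polynomial F))) *
      Matrix.of (fun (κ : Fin N) (a : Fin m) => (Polynomial.X : (Polynomial F)) ^ (((κ : ℕ) + 1) * ((a : ℕ) + 1)))).map ψ
    with hD
  have hDdet : D.det ≠ 0 := by
    rw [hD, ← RingHom.mapMatrix_apply, ← RingHom.map_det]
    exact (map_ne_zero_iff ψ (IsFractionRing.injective (Polynomial F) K)).2 hGR
  -- the entries of `D` are those of the `vecMul` family on the first `m` columns
  have hDentry : ∀ (a b : Fin m), D a b =
      Matrix.vecMul (fun κ => φ (v₀ (e.symm a) κ))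
        (Matrix.of fun (κ : Fin N) (b : Fin μ) => ψ (Polynomial.X ^ (((b : ℕ) + 1) * ((κ : ℕ) + 1))))
        (Fin.castLE hs b) := by
    intro a b
    simp only [hD, Matrix.map_apply, Matrix.mul_apply, Matrix.of_apply, map_sum, map_mul,
      Matrix.vecMul, dotProduct, Fin.val_castLE, hQ, hφψ, RingHom.comp_apply]
    refine Finset.sum_congr rfl fun κ _ => ?_
    rw [Nat.mul_comm]
  rw [Fintype.linearIndependent_iff]
  intro g hg
  -- `g ∘ e⁻¹` is in the left kernel of `D`
  have hker : Matrix.vecMul (fun a => g (e.symm a)) D = 0 := by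
    funext b
    have := congrFun hg (Fin.castLE hs b)
    simp only [Finset.sum_apply, Pi.smul_apply, smul_eq_mul, Pi.zero_apply] at this
    rw [Matrix.vecMul, dotProduct]
    simp_rw [hDentry]
    rw [← Equiv.sum_comp e.symm] at this
    simpa using this
  have hz := Matrix.eq_zero_of_vecMul_eq_zero hDdet hker
  intro p
  have := congrFun hz (e p)
  simpa using this

end Vandermonde

section MinorPreservation

variable {F : Type*} [Field F]

/-- **[ASSS16, §3] for the map of FSV Lemma 23: the formal-`s` Vandermonde substitution
`X_κ ↦ Σ_{b<μ} z_b s^{(b+1)(κ+1)}` keeps every non-zero `r × r` Jacobian minor (`r < μ`) of products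
of affine forms non-zero** ("if we construct a `Ψ` that keeps `J_{x_k}(T_k)` nonzero then `Ψ` can
easily be extended to a homomorphism … faithful to `T`" + Thm. 3.2 + "one of the maps
`Ψ_b : x_i ↦ Σ_{j=1}^{k+1} z_j b^{ij}` … is a rank-`(k+1)` preserving map", here with the formal
`b = s` of FSV). Proof: eq. (1) (`det_jacobian_submatrix_prod_affine`) over `𝔽(s)`, re-indexed
(`sum_graph_eq_sum_powersetCard`), is an instance of `aeval_affine_ne_zero_of_rankPreserving`
(support: `linearIndependent_of_graph_det_ne_zero`; rank preservation:
`linearIndependent_vecMul_vandermonde`); the `𝔽(s)`-substitution is the `𝔽`-one followed by the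
coefficient map `𝔽[z, s] → 𝔽(s)[z]`. [cite: AgrawalEtAl2011, §3 (Thm. 3.2 and the paragraph before it)]
locator: paper:arxiv-1111.0582 p0007.txt:L14–L22, L96–L110 -/
theorem aeval_vandermonde_det_jacobian_ne_zero {N m d r μ : ℕ} (c : Fin m → Fin d → F)
    (v : Fin m → Fin d → Fin N → F) (ρ : Fin r → Fin m) (γ : Fin r → Fin N) (hr : r + 1 ≤ μ)
    (hH : ((Literature.Algebra.Polynomial.JacobianCriterion.jacobianMatrix (fun i => ∏ j,
        (C (c i j) + ∑ x, C (v i j x) * X x : MvPolynomial (Fin N) F))).submatrix ρ γ).det ≠ 0) :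
    aeval (fun κ : Fin N => ∑ b : Fin μ, (X (Sum.inl b) : MvPolynomial (Fin μ ⊕ Unit) F) *
        X (Sum.inr ()) ^ (((b : ℕ) + 1) * ((κ : ℕ) + 1)))
      ((Literature.Algebra.Polynomial.JacobianCriterion.jacobianMatrix (fun i => ∏ j,
        (C (c i j) + ∑ x, C (v i j x) * X x : MvPolynomial (Fin N) F))).submatrix ρ γ).det ≠ 0 := by
  classical
  set H := ((Literature.Algebra.Polynomial.JacobianCriterion.jacobianMatrix (fun i => ∏ j,
        (C (c i j) + ∑ x, C (v i j x) * X x : MvPolynomial (Fin N) F))).submatrix ρ γ).det with hHdef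
  set Φv : Fin N → MvPolynomial (Fin μ ⊕ Unit) F := fun κ => ∑ b : Fin μ,
    (X (Sum.inl b) : MvPolynomial (Fin μ ⊕ Unit) F) * X (Sum.inr ()) ^ (((b : ℕ) + 1) * ((κ : ℕ) + 1))
    with hΦv
  -- the data over `K = F(s)`
  set cK : Fin r × Fin d → (FractionRing (Polynomial F)) := fun p => algebraMap F (FractionRing (Polynomial F)) (c (ρ p.1) p.2) with hcK
  set vK : Fin r × Fin d → Fin N → (FractionRing (Polynomial F)) := fun p κ => algebraMap F (FractionRing (Polynomial F)) (v (ρ p.1) p.2 κ) with hvK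
  set αK : Finset (Fin r × Fin d) → (FractionRing (Polynomial F)) := fun L => ∑ J : Fin r → Fin d,
      if Finset.univ.image (fun a => (a, J a)) = L then
        Matrix.det (Matrix.of fun a b : Fin r => vK (a, J a) (γ b)) else 0 with hαK
  set W : Matrix (Fin N) (Fin μ) (FractionRing (Polynomial F)) := Matrix.of fun (κ : Fin N) (b : Fin μ) =>
      algebraMap (Polynomial F) (FractionRing (Polynomial F)) (Polynomial.X ^ (((b : ℕ) + 1) * ((κ : ℕ) + 1))) with hW
  set NK : MvPolynomial (Fin N) (FractionRing (Polynomial F)) := ∑ L ∈ (Finset.univ : Finset (Fin r × Fin d)).powersetCard r,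
      C (αK L) * ∏ p ∈ Finset.univ \ L, (C (cK p) + ∑ x, C (vK p x) * X x) with hNK
  -- `map (algebraMap F (FractionRing (Polynomial F))) H = NK` (eq. (1), mapped to `K` and re-indexed)
  have hstep : ∀ J : Fin r → Fin d, MvPolynomial.map (algebraMap F (FractionRing (Polynomial F)))
      (C (Matrix.det (Matrix.of fun a b : Fin r => v (ρ a) (J a) (γ b))) *
        ∏ a, ∏ j ∈ Finset.univ.erase (J a),
          (C (c (ρ a) j) + ∑ x, C (v (ρ a) j x) * X x : MvPolynomial (Fin N) F)) =
      C (Matrix.det (Matrix.of fun a b : Fin r => vK (a, J a) (γ b))) *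
        ∏ a, ∏ j ∈ Finset.univ.erase (J a), (C (cK (a, j)) + ∑ x, C (vK (a, j) x) * X x) := by
    intro J
    rw [map_mul, map_C, RingHom.map_det, map_prod]
    have e1 : (algebraMap F (FractionRing (Polynomial F))).mapMatrix (Matrix.of fun a b : Fin r => v (ρ a) (J a) (γ b)) =
        Matrix.of fun a b : Fin r => vK (a, J a) (γ b) := by
      ext a b
      simp [hvK]
    rw [e1]
    congr 1
    refine Finset.prod_congr rfl fun a _ => ?_
    rw [map_prod]
    refine Finset.prod_congr rfl fun j _ => ?_
    simp [map_add, map_sum, map_mul, map_C, map_X, hcK, hvK]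
  have hflat := sum_graph_eq_sum_powersetCard (R := MvPolynomial (Fin N) (FractionRing (Polynomial F)))
    (fun J : Fin r → Fin d => C (Matrix.det (Matrix.of fun a b : Fin r => vK (a, J a) (γ b))))
    (fun p => C (cK p) + ∑ x, C (vK p x) * X x)
  beta_reduce at hflat
  have hmapH : MvPolynomial.map (algebraMap F (FractionRing (Polynomial F))) H = NK := by
    rw [hHdef, det_jacobian_submatrix_prod_affine c v ρ γ, map_sum]
    simp_rw [hstep]
    rw [hflat, hNK]
    refine Finset.sum_congr rfl fun L _ => ?_
    congr 1
    simp only [hαK, map_sum, apply_ite C, map_zero]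
  have hNK0 : NK ≠ 0 := by
    rw [← hmapH]
    intro h0
    exact hH (MvPolynomial.map_injective (algebraMap F (FractionRing (Polynomial F))) (algebraMap F (FractionRing (Polynomial F))).injective (by rw [h0, map_zero]))
  -- the certificate
  have hcore := aeval_affine_ne_zero_of_rankPreserving (K := FractionRing (Polynomial F)) (ι := Fin r × Fin d) (n := N)
    (μ := μ) r Finset.univ cK vK αK 0 W
    (fun L hL => linearIndependent_of_graph_det_ne_zero vK γ L hL)
    (fun s hs hli => by
      have h := linearIndependent_vecMul_vandermonde (μ := μ) (fun p : Fin r × Fin d => v (ρ p.1) p.2) s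
        (hs.trans hr) hli
      exact h)
    hNK0
  -- the coefficient map `F[z, s] → K[z]`
  set ιK : MvPolynomial (Fin μ ⊕ Unit) F →+* MvPolynomial (Fin μ) (FractionRing (Polynomial F)) :=
    eval₂Hom (C.comp (algebraMap F (FractionRing (Polynomial F)))) (Sum.elim (fun b => X b) (fun _ => C (algebraMap (Polynomial F) (FractionRing (Polynomial F)) Polynomial.X))) with hιK
  have hcomm : ∀ G : MvPolynomial (Fin N) F,
      aeval (fun x : Fin N => (C ((0 : Fin N → FractionRing (Polynomial F)) x) + ∑ b, C (W x b) * X b : MvPolynomial (Fin μ) (FractionRing (Polynomial F))))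
        (MvPolynomial.map (algebraMap F (FractionRing (Polynomial F))) G) = ιK (aeval Φv G) := by
    intro G
    have hext : ((aeval (fun x : Fin N => (C ((0 : Fin N → FractionRing (Polynomial F)) x) + ∑ b, C (W x b) * X b :
        MvPolynomial (Fin μ) (FractionRing (Polynomial F))))).toRingHom.comp (MvPolynomial.map (algebraMap F (FractionRing (Polynomial F))))) =
        ιK.comp (aeval Φv).toRingHom := by
      refine MvPolynomial.ringHom_ext (fun a => ?_) (fun κ => ?_)
      · simp only [RingHom.comp_apply, AlgHom.toRingHom_eq_coe, AlgHom.coe_toRingHom, map_C, aeval_C,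
          algebraMap_eq, hιK, coe_eval₂Hom, eval₂_C, RingHom.comp_apply]
      · simp only [RingHom.comp_apply, AlgHom.toRingHom_eq_coe, AlgHom.coe_toRingHom, map_X, aeval_X,
          Pi.zero_apply, C_0, zero_add, hW, Matrix.of_apply, hΦv, hιK, map_sum, map_mul, map_pow,
          coe_eval₂Hom, eval₂_X, Sum.elim_inl, Sum.elim_inr]
        refine Finset.sum_congr rfl fun b _ => ?_
        rw [mul_comm]
    exact RingHom.congr_fun hext G
  have hcore' : ιK (aeval Φv H) ≠ 0 := by
    rw [← hcomm, hmapH]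
    exact hcore
  intro h0
  apply hcore'
  rw [h0, map_zero]

end MinorPreservation

end ASSS16


/-! ### FSV Lemma 23 [ASSS16, §3] from Lemma 52 [ASSS16, Lemma 2.2] -/

section LemmaTwentyThree

open MvPolynomial Finset Matrix Literature.Algebra.Polynomial.JacobianCriterion
  Literature.Barriers.ValiantsHypothesis

variable {F : Type*} [Field F] {n : ℕ}

/-- **FSV Lemma 23 (ToC Lemma 4.8) [ASSS16, §3] from FSV Lemma 52 (= ASSS Lemma 2.2), PROVED.**
Printed (Lemma 23): "the map `Ψ : X_i ↦ Σ_{j=1}^{k+1} z_j s^{ij} + Σ_{j=1}^{k} y_j t^{ij}` … is a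
generator for the class of polynomials `F = C(T_1, …, T_M)`, where the `T_i`'s are products of
linear functions and `trdeg{T_1, …, T_m} ≤ k`" (characteristic `0` or `> d^k`). Printed proof
([ASSS16, §3]): "By Lemma 2.2 [= FSV Lemma 52], if we construct a `Ψ : 𝔽[x] → 𝔽[z]` that keeps
`J_{x_k}(T_k)` nonzero then `Ψ` can easily be extended to a homomorphism `Φ : 𝔽[x] → 𝔽[z, t, y]`
that is faithful to `T`. And hence, by Theorem 2.1, `Φ(D) = 0` iff `D = 0`" — the `z, s`-block is the
rank-`(k+1)`-preserving map of Thm. 3.2 (`ASSS16.aeval_vandermonde_det_jacobian_ne_zero`: it keeps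
every non-zero maximal Jacobian minor of the `T_i` non-zero, the maximal size being
`rank Jac ≤ trdeg ≤ k` by `jacobianRank_le_of_trdegLE`), so it "preserves the rank of the
Jacobian" (`jacobianRank_eq_rank_map_of_minors`, val-lit t21), and Lemma 52's map composed with it
is, after the identification `i = binIndex m` (`binIndex_eq_binaryOrder_symm_succ`), the map `Ψ` of
Lemma 23 (`asssPsiGenCoeff`). [cite: ForbesShpilkaVolk2018, Lemma 23 (seq.) = ToC Lemma 4.8; AgrawalEtAl2011, §3 (Thm. 3.2 and the composition lemma 2.2)]
locator: paper:arxiv-1701.05328 p0017.txt:L5–L13; paper:arxiv-1111.0582 p0007.txt:L8–L22 -/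
theorem isHittingSetGenerator_asssPsiGenCoeff_of_lemma52 (h52 : ForbesShpilkaVolk2018_lemma52 F)
    (n k d : ℕ) (hchar : ringChar F = 0 ∨ d ^ k < ringChar F) :
    IsHittingSetGenerator (trdegProductClass F (multilinearMonomials n) k d)
      (fun m : multilinearMonomials n => asssPsiGenCoeff F n k (m : Fin n →₀ ℕ)) := by
  classical
  intro D hD hD0
  obtain ⟨M₀, L, C', hL1, hLtr, rfl⟩ := hD
  -- the data fed to Lemma 52
  set e : multilinearMonomials n ≃ Fin (2 ^ n) := (binaryOrder n).symm with he
  let τ := Fin (k + 1) ⊕ Unit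
  let M₁ := Fintype.card τ
  let eτ : τ ≃ Fin M₁ := Fintype.equivFin τ
  -- the affine data of the linear factors, in the coordinates `Fin (2^n)`
  set c : Fin M₀ → Fin d → F := fun i j => coeff 0 (rename e (L i j)) with hc
  set v : Fin M₀ → Fin d → Fin (2 ^ n) → F := fun i j x =>
    coeff (Finsupp.single x 1) (rename e (L i j)) with hv
  have hLe : ∀ i j, rename e (L i j) =
      (C (c i j) + ∑ x, C (v i j x) * X x : MvPolynomial (Fin (2 ^ n)) F) := fun i j =>
    Literature.NumberTheory.DiophantineGeometry.eq_C_add_sum_of_totalDegree_le_one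
      ((totalDegree_rename_le _ _).trans (hL1 i j))
  let Fv : Fin M₀ → MvPolynomial (Fin (2 ^ n)) F := fun i =>
    ∏ j, (C (c i j) + ∑ x, C (v i j x) * X x : MvPolynomial (Fin (2 ^ n)) F)
  have hFv : ∀ i, Fv i = rename e (∏ j, L i j) := by
    intro i
    rw [map_prod]
    exact Finset.prod_congr rfl fun j _ => (hLe i j).symm
  -- the `z, s`-block `Φ` (the Vandermonde map with `k+1` seeds and the formal `s`)
  let Φv : Fin (2 ^ n) → MvPolynomial τ F := fun κ => ∑ b : Fin (k + 1),
    (X (Sum.inl b) : MvPolynomial τ F) * X (Sum.inr ()) ^ (((b : ℕ) + 1) * ((κ : ℕ) + 1))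
  have hΦv : ∀ κ : Fin (2 ^ n), vdmGenCoeff F n (k + 1) ((e.symm κ : multilinearMonomials n) : Fin n →₀ ℕ) = Φv κ := by
    intro κ
    rw [vdmGenCoeff, binIndex_eq_binaryOrder_symm_succ, he, Equiv.symm_symm, Equiv.symm_apply_apply]
  let Φ : MvPolynomial (Fin (2 ^ n)) F →ₐ[F] MvPolynomial (Fin M₁) F :=
    aeval fun κ => rename eτ (Φv κ)
  have hdeg : ∀ i, (Fv i).totalDegree ≤ d := by
    intro i
    rw [hFv]
    refine (totalDegree_rename_le _ _).trans ((totalDegree_finsetProd _ _).trans ?_)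
    calc ∑ j, (L i j).totalDegree ≤ ∑ _j : Fin d, 1 := Finset.sum_le_sum fun j _ => hL1 i j
      _ = d := by simp
  have htr : TrdegLE F Fv k := by
    intro S hS
    refine hLtr S (AlgebraicIndependent.of_comp (rename e : _ →ₐ[F] MvPolynomial (Fin (2 ^ n)) F) ?_)
    convert hS using 1
    funext i
    simp only [Function.comp_apply]
    exact (hFv i).symm
  have hρ : jacobianRank Fv ≤ k := jacobianRank_le_of_trdegLE htr
  -- `Φ` preserves the rank of the Jacobian ([ASSS16] §3)
  have hrank : jacobianRank Fv = ((jacobianMatrix Fv).map fun q =>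
      algebraMap (MvPolynomial (Fin M₁) F) (FractionRing (MvPolynomial (Fin M₁) F)) (Φ q)).rank := by
    refine jacobianRank_eq_rank_map_of_minors Fv Φ fun ρ γ hμ => ?_
    have hkey := ASSS16.aeval_vandermonde_det_jacobian_ne_zero (μ := k + 1) c v ρ γ
      (Nat.succ_le_succ hρ) hμ
    have hΦeq : ∀ G : MvPolynomial (Fin (2 ^ n)) F, Φ G = rename eτ (aeval Φv G) := by
      intro G
      rw [comp_aeval_apply]
    rw [hΦeq]
    intro h0
    exact hkey (rename_injective _ eτ.injective (by rw [h0, map_zero]))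
  -- Lemma 52
  have hL : aeval Fv C' ≠ 0 := by
    have : aeval Fv C' = rename e (aeval (fun i => ∏ j, L i j) C') := by
      rw [comp_aeval_apply]
      exact congrArg (fun f => aeval f C') (funext hFv)
    rw [this]
    exact fun h0 => hD0 (rename_injective _ e.injective (by rw [h0, map_zero]))
  have h52' := (h52 (2 ^ n) M₀ M₁ d k Fv C' Φ hdeg htr hchar hrank).1 hL
  -- Lemma 52's map `Ψ` on the coordinate `κ`
  let ψ : Fin (2 ^ n) → MvPolynomial (Fin M₁ ⊕ (Fin k ⊕ Unit)) F := fun κ =>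
    (∑ j : Fin k, (X (Sum.inr (Sum.inl j)) : MvPolynomial (Fin M₁ ⊕ (Fin k ⊕ Unit)) F) *
        X (Sum.inr (Sum.inr ())) ^ (((κ : ℕ) + 1) * ((j : ℕ) + 1))) +
      rename Sum.inl (Φ (X κ))
  change aeval (fun i => aeval ψ (Fv i)) C' ≠ 0 at h52'
  have h52'' : bind₁ (ψ ∘ e) (aeval (fun i => ∏ j, L i j) C') ≠ 0 := by
    have : aeval (fun i => aeval ψ (Fv i)) C' = bind₁ (ψ ∘ e) (aeval (fun i => ∏ j, L i j) C') := by
      have h1 : (fun i => aeval ψ (Fv i)) = fun i => (aeval (ψ ∘ e)) (∏ j, L i j) := by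
        funext i
        rw [hFv]
        exact aeval_rename _ _ _
      rw [h1, ← comp_aeval, AlgHom.comp_apply]
      rfl
    rw [← this]
    exact h52'
  -- the renaming `θ` of the seeds of `Ψ` (Lemma 23) into those of Lemma 52's map
  let θ : ((Fin (k + 1) ⊕ Unit) ⊕ (Fin k ⊕ Unit)) → MvPolynomial (Fin M₁ ⊕ (Fin k ⊕ Unit)) F :=
    Sum.elim (fun w => X (Sum.inl (eτ w))) fun u => X (Sum.inr u)
  have hθ : ∀ m : multilinearMonomials n,
      bind₁ θ (asssPsiGenCoeff F n k (m : Fin n →₀ ℕ)) = ψ (e m) := by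
    intro m
    rw [asssPsiGenCoeff, map_add, bind₁_rename, bind₁_rename, add_comm]
    have hl : θ ∘ Sum.inl = fun w => X (Sum.inl (eτ w)) := rfl
    have hr : θ ∘ Sum.inr = fun u => X (Sum.inr u) := rfl
    rw [hl, hr]
    show _ = (∑ j : Fin k, (X (Sum.inr (Sum.inl j)) : MvPolynomial (Fin M₁ ⊕ (Fin k ⊕ Unit)) F) *
        X (Sum.inr (Sum.inr ())) ^ ((((e m : Fin (2 ^ n)) : ℕ) + 1) * ((j : ℕ) + 1))) +
      rename Sum.inl (Φ (X (e m)))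
    congr 1
    · rw [vdmGenCoeff, map_sum]
      refine Finset.sum_congr rfl fun j _ => ?_
      rw [map_mul, map_pow, bind₁_X_right, bind₁_X_right, binIndex_eq_binaryOrder_symm_succ, ← he,
        Nat.mul_comm]
    · change _ = rename Sum.inl (aeval (fun κ => rename eτ (Φv κ)) (X (e m)))
      rw [aeval_X, ← hΦv, Equiv.symm_apply_apply, rename_rename]
      have hb : (bind₁ (fun w : τ => (X (Sum.inl (eτ w)) : MvPolynomial (Fin M₁ ⊕ (Fin k ⊕ Unit)) F))) =
          rename (Sum.inl ∘ eτ) := by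
        refine MvPolynomial.algHom_ext fun w => ?_
        rw [bind₁_X_right, rename_X]
        rfl
      rw [hb]
  -- conclude: `D ∘ Ψ = 0` would specialise to `C(Ψ₅₂(F)) = 0`
  intro hcomp
  apply h52''
  have h := congrArg (bind₁ θ) hcomp
  rw [map_zero, bind₁_bind₁] at h
  have hfun : (fun m : multilinearMonomials n => bind₁ θ (asssPsiGenCoeff F n k (m : Fin n →₀ ℕ))) =
      ψ ∘ e :=
    funext hθ
  rwa [hfun] at h

/-- **FSV Lemma 23 REDUCED to Lemma 52 [ASSS16, Lemma 2.2]:** the named fact `FSV2018_lemma23`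
from `∀ F, ForbesShpilkaVolk2018_lemma52 F`. [cite: ForbesShpilkaVolk2018, Lemma 23 (seq.) = ToC Lemma 4.8; AgrawalEtAl2011, §3] -/
theorem FSV2018_lemma23_of_lemma52
    (h52 : ∀ (F : Type) [Field F], ForbesShpilkaVolk2018_lemma52 F) : FSV2018_lemma23 :=
  fun F _ n k d hchar => isHittingSetGenerator_asssPsiGenCoeff_of_lemma52 (h52 F) n k d hchar

/-- **FSV Lemma 23 modulo the Jacobian criterion (Fact 51 [BMS13]) alone:** Lemma 52 ⇐ Fact 51
(`ForbesShpilkaVolk2018_lemma52_of_fact51`, val-lit t18). [cite: ForbesShpilkaVolk2018, Lemma 23 and Fact 51 (seq.) = ToC Lemma 4.8, Fact 6.2; AgrawalEtAl2011, §3] -/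
theorem FSV2018_lemma23_of_fact51
    (h51 : ∀ (F : Type) [Field F], ForbesShpilkaVolk2018_fact51 F) : FSV2018_lemma23 :=
  FSV2018_lemma23_of_lemma52 fun F _ => ForbesShpilkaVolk2018_lemma52_of_fact51 (h51 F)

/-- **FSV Lemma 23 over every field, modulo the sharp Perron theorem** (Fact 51 ⇐ Perron,
`ForbesShpilkaVolk2018_fact51_of_perron`, val-lit t21). [cite: ForbesShpilkaVolk2018, Lemma 23 (seq.) = ToC Lemma 4.8; BeeckenMittmannSaxena2013, Thm. 4] -/
theorem FSV2018_lemma23_of_perron (hP : Literature.RingTheory.Nullstellensatz.perronTheorem_sharp) :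
    FSV2018_lemma23 :=
  FSV2018_lemma23_of_lemma52 fun _ _ => ForbesShpilkaVolk2018_lemma52_of_perron hP

/-- **FSV Lemma 23 is a THEOREM in characteristic `0`:** the map `Ψ` of Lemma 23 is a hitting-set
generator for `C(T_1, …, T_M)` (`T_i` products of `d` linear functions, `trdeg ≤ k`) over every
field of characteristic `0` — Lemma 52 is unconditional there (`ForbesShpilkaVolk2018_lemma52_of_charZero`).
[cite: ForbesShpilkaVolk2018, Lemma 23 (seq.) = ToC Lemma 4.8; AgrawalEtAl2011, §3] -/
theorem isHittingSetGenerator_asssPsiGenCoeff_of_charZero [CharZero F] (n k d : ℕ) :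
    IsHittingSetGenerator (trdegProductClass F (multilinearMonomials n) k d)
      (fun m : multilinearMonomials n => asssPsiGenCoeff F n k (m : Fin n →₀ ℕ)) :=
  isHittingSetGenerator_asssPsiGenCoeff_of_lemma52 ForbesShpilkaVolk2018_lemma52_of_charZero n k d
    (Or.inl (ringChar.eq F 0))

/-- **FSV Thm. 24 (ToC Thm. 4.9) modulo Lemma 52 [ASSS16]** (Thm. 24 ⇐ Lemma 23, t18's
`FSV2018_thm24_of_lemma23`). [cite: ForbesShpilkaVolk2018, Thm. 24 (seq.) = ToC Thm. 4.9] -/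
theorem FSV2018_thm24_of_lemma52
    (h52 : ∀ (F : Type) [Field F], ForbesShpilkaVolk2018_lemma52 F) : FSV2018_thm24 :=
  FSV2018_thm24_of_lemma23 (FSV2018_lemma23_of_lemma52 h52)

/-- **FSV Thm. 9 (ToC Thm. 1.10), bullet "bounded transcendence degree" (= Thm. 24), modulo the
sharp Perron theorem alone.** [cite: ForbesShpilkaVolk2018, Thm. 9 bullet 2 and Thm. 24 (seq.) = ToC Thm. 1.10, Thm. 4.9; BeeckenMittmannSaxena2013, Thm. 4] -/
theorem FSV2018_thm9_trdeg_of_perron (hP : Literature.RingTheory.Nullstellensatz.perronTheorem_sharp) :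
    FSV2018_thm9_trdeg :=
  FSV2018_thm9_trdeg_of_thm24 (FSV2018_thm24_of_lemma23 (FSV2018_lemma23_of_perron hP))

/-- **FSV Thm. 9 (ToC Thm. 1.10) from TWO printed external results and the sharp Perron
theorem:** `FSV2018_thm9_of_threeFacts_of_perron` (`FSV18Thm9AssemblyL40`: Lemma 40 is the
theorem `FSV2018_lemma40_holds`, Lemma 53 ⇐ Perron) with its Lemma-23 input discharged by
`FSV2018_lemma23_of_perron`; the residual named facts of the N1 row are Fact 19 [SS rank bounds]
and Thm. 48 [ASSS16 occur-`k`], plus `perronTheorem_sharp` [BMS13 Thm. 4 = Płoski 2005].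
[cite: ForbesShpilkaVolk2018, Thm. 9 (seq.) = ToC Thm. 1.10; BeeckenMittmannSaxena2013, Thm. 4] -/
theorem FSV2018_thm9_of_twoFacts_of_perron (h19 : FSV2018_fact19) (h48 : FSV2018_thm48)
    (hP : Literature.RingTheory.Nullstellensatz.perronTheorem_sharp) : FSV2018_thm9 :=
  FSV2018_thm9_of_threeFacts_of_perron h19 (FSV2018_lemma23_of_perron hP) h48 hP

/-- **FSV Thm. 9 (ToC Thm. 1.10) from Fact 19, Thm. 48 and [ASSS16, Lemma 2.2] (= FSV Lemma 52)
over all fields:** both §4.2 (Lemma 23, this file) and §6 (Lemma 53, val-lit t21's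
`ForbesShpilkaVolk2018_lemma53_of_lemma52`) hang on Lemma 52 alone.
[cite: ForbesShpilkaVolk2018, Thm. 9 (seq.) = ToC Thm. 1.10; AgrawalEtAl2011, Lemma 2.2] -/
theorem FSV2018_thm9_of_twoFacts_of_lemma52 (h19 : FSV2018_fact19) (h48 : FSV2018_thm48)
    (h52 : ∀ (F : Type) [Field F], ForbesShpilkaVolk2018_lemma52 F) : FSV2018_thm9 :=
  FSV2018_thm9_of_fourFacts h19 (FSV2018_lemma23_of_lemma52 h52) h48
    fun F _ => ForbesShpilkaVolk2018_lemma53_of_lemma52 (h52 F)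

/-- **FSV Thm. 9 (ToC Thm. 1.10) from Fact 19, Thm. 48 and the Jacobian criterion Fact 51
[BMS13] over all fields.** [cite: ForbesShpilkaVolk2018, Thm. 9 and Fact 51 (seq.) = ToC Thm. 1.10, Fact 6.2] -/
theorem FSV2018_thm9_of_twoFacts_of_fact51 (h19 : FSV2018_fact19) (h48 : FSV2018_thm48)
    (h51 : ∀ (F : Type) [Field F], ForbesShpilkaVolk2018_fact51 F) : FSV2018_thm9 :=
  FSV2018_thm9_of_twoFacts_of_lemma52 h19 h48 fun F _ => ForbesShpilkaVolk2018_lemma52_of_fact51 (h51 F)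

end LemmaTwentyThree

end Literature.Computability.AlgebraicComplexity

end
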